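import Literature.AlgebraicGeometry.Motives.AbelianVarietyTranslatedDerivations
import HarnessLib

/-!
# Translated tangent vectors of an abelian variety are linearly independent at every point

Topic `Literature/AlgebraicGeometry/Motives`, namespace
`Literature.AlgebraicGeometry.Motives.AbelianVariety`. Theorems and auxiliary definitions (no named
fact; net Literature debt 0). Third file of route D′ towards `Mumford1970_cotangentSheaf_abelianVariety_free`
(Görtz–Wedhorn II Prop. 27.15: `Ω¹_{G/k}` free for a group scheme over a field) — the HOMOGENEITY
statement in point-free currency: the translates to ANY point `x` (residue field not `K`) of independent
tangent vectors at the origin stay independent.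

* `tangentHomOfAlg L ℓ`, `tangentPtOfAlg L ℓ` — the `L[ε]`-point of `A` at the origin attached to a linear form
  `ℓ` on `𝔪_e/𝔪_e²` (the tree's `tangentHom`/`tangentPt` of `Motives/AbelianVarietyLie` read in a field
  `L ⊇ K`; Görtz–Wedhorn II, (27.4.6)); `tangentPtOfAlg_mem` (it lies in `Ker(A(L[ε]) → A(L))`),
  `evAtPt_tangentPtOfAlg`, `evAtPt_one`, `translatedDerivation_origin_tangentPtOfAlg` (at the origin its point
  derivation is `ℓ`).
* **`linearIndependent_translatedDerivation`** — for linear forms `ℓ i` with dual elements `a j`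
  (`ℓ i (a i) = 1`, `ℓ i (a j) = 0`, `i ≠ j`), every field `L ⊇ K` and every `L`-point `ξ` of `A` based at
  `x`, the `L`-valued point derivations `∂_{ξ₀ · t_{ℓ i}} : 𝒪_{A,x} → L` are `L`-linearly independent.
  Proof: a vanishing combination `∑ g i ∂_{ξ₀·t_{ℓ i}}` is `∂_{ξ₀·T}` for the single tangent vector
  `T = ∏ (g i)·t_{ℓ i}` (`translatedDerivation_prod_scale`), so `T = 1` by cancellation in `A(L[ε])`
  (`translatedDerivation_eq_zero_iff`); reading `T = 1` at the origin gives `∑ g i ℓ i = 0` on `𝒪_{A,e}`,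
  whence `g = 0` on the dual elements. This is the content of «a group variety is homogeneous»
  (Görtz–Wedhorn II Prop. 27.15 obtains it from the cartesian square `(m, p₁)` on `G × G`) without
  rational points, products or base change.

Presearch: [corpus: book:gortz2023 p. 805 Prop. 27.15, p. 806 Rem. 27.18 (3)–(4)] — statement and the
dual-number dictionary; the point-free independence statement is not in print as such; `lit search
--hybrid` / `vsearch`: GW II pp. 805–806, Bosch AGCA p. 409, Hartshorne II.8; galaxy «invariant
derivations|invariant differential forms|Lie algebra of a group scheme»: no usable hit. Mathlib searched
and used: `linearIndependent_iff'`, `Finset.sum_eq_single`, `TrivSqZeroExt.algebraMap_eq_inl'`; in this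
tree: `ptOver`, `evAt_ptOfStalkHom`, `ptOfStalkHom_closedPoint`, `linearForm_leibniz`, `evalOrigin`,
`evalOrigin_algebraMap`, `one_left_base` (`Motives/AbelianVarietyLie`). No `instance` is declared.

## References

* [GortzWedhorn2023] U. Görtz, T. Wedhorn, *Algebraic Geometry II* (2023): Prop. 27.15 (p. 805),
  Rem. 27.18 (3)–(4) and (27.4.6) (p. 806).
* [MumfordAV1970] D. Mumford, *Abelian Varieties* (1970), §4 (iii).
-/

universe u

open CategoryTheory AlgebraicGeometry
open scoped MonObj

noncomputable section

namespace Literature.AlgebraicGeometry.Motives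

namespace AbelianVariety

open TrivSqZeroExt AlgPoints

variable {K : Type u} [Field K] {A : AbelianVariety K}

/-! ### `L`-valued tangent vectors at the origin attached to linear forms on `𝔪_e/𝔪_e²` -/

section TangentOf

variable {R S : Type u} [CommRing R] [CommRing S] (s : K →+* R)

variable (ℓ : stalkOrigin A →+ K)
  (hℓs : ∀ (c : K) (a : stalkOrigin A), ℓ (stalkOriginAlgebraMap A c * a) = c * ℓ a)
  (hℓK : ∀ c : K, ℓ (stalkOriginAlgebraMap A c) = 0)
  (hℓ2 : ∀ x ∈ IsLocalRing.maximalIdeal (stalkOrigin A) ^ 2, ℓ x = 0)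

/-- The `R[ε]`-valued tangent vector `a ↦ s(ev_e(a)) + s(ℓ(a)) ε : 𝒪_{A,e} → R[ε]` of a linear form `ℓ`
on `𝔪_e/𝔪_e²`, read in a commutative ring `R` along `s : K → R` (the tree's `tangentHom` followed by
`K[ε] → R[ε]`; Görtz–Wedhorn II, (27.4.6): `Lie(G)(U) = Ker(G(U[ε]) → G(U))` for ANY `U`).
[cite: GortzWedhorn2023, Rem. 27.18 (4) and (27.4.6)] -/
def tangentHomOf : stalkOrigin A →+* DualNumber R where
  toFun a := inl (s (evalOrigin A a)) + inr (s (ℓ a))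
  map_one' := by
    have h1 : ℓ 1 = 0 := by rw [← map_one (stalkOriginAlgebraMap A)]; exact hℓK 1
    rw [map_one, h1, map_zero, map_one, inr_zero, add_zero]
    rfl
  map_mul' a b := by
    apply TrivSqZeroExt.ext
    · simp only [fst_add, fst_inl, fst_inr, add_zero, fst_mul, map_mul]
    · simp only [snd_add, snd_inl, snd_inr, zero_add, snd_mul, fst_add, fst_inl, fst_inr, add_zero,
        smul_eq_mul, MulOpposite.smul_eq_mul_unop, MulOpposite.unop_op,
        linearForm_leibniz ℓ hℓs hℓK hℓ2, map_add, map_mul]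
      ring
  map_zero' := by rw [map_zero, map_zero, map_zero, map_zero, inl_zero, inr_zero, add_zero]
  map_add' a b := by
    rw [map_add, map_add, map_add, map_add, inl_add, inr_add]
    abel

/-- The constant part of `tangentHomOf s ℓ` is evaluation at the origin (read along `s`). [cite: GortzWedhorn2020, (6.4) Prop. 6.7] [cite: GortzWedhorn2023, Rem. 27.18 (4) and (27.4.6)] -/
theorem fst_tangentHomOf_apply (a : stalkOrigin A) :
    (tangentHomOf s ℓ hℓs hℓK hℓ2 a).fst = s (evalOrigin A a) := by
  change (inl (s (evalOrigin A a)) + inr (s (ℓ a)) : DualNumber R).fst = _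
  rw [fst_add, fst_inl, fst_inr, add_zero]

/-- The `ε`-part of `tangentHomOf s ℓ` is `ℓ` (read along `s`). [cite: GortzWedhorn2020, (6.4) Prop. 6.7] [cite: GortzWedhorn2023, Rem. 27.18 (4) and (27.4.6)] -/
theorem snd_tangentHomOf_apply (a : stalkOrigin A) :
    (tangentHomOf s ℓ hℓs hℓK hℓ2 a).snd = s (ℓ a) := by
  change (inl (s (evalOrigin A a)) + inr (s (ℓ a)) : DualNumber R).snd = _
  rw [snd_add, snd_inl, snd_inr, zero_add]

/-- `tangentHomOf s ℓ` is compatible with the `K`-structures: on constants it is `c ↦ s(c)`. [cite: GortzWedhorn2020, (6.4) Prop. 6.7] [cite: GortzWedhorn2023, Rem. 27.18 (4) and (27.4.6)] -/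
theorem tangentHomOf_comp_stalkOriginAlgebraMap :
    (tangentHomOf s ℓ hℓs hℓK hℓ2).comp (stalkOriginAlgebraMap A) = (inlHom R R).comp s := by
  ext c
  · rw [RingHom.comp_apply, fst_tangentHomOf_apply, evalOrigin_algebraMap, RingHom.comp_apply,
      inlHom_apply, fst_inl]
  · rw [RingHom.comp_apply, snd_tangentHomOf_apply, hℓK, map_zero, RingHom.comp_apply, inlHom_apply,
      snd_inl]

/-- Reducing `tangentHomOf s ℓ` modulo `ε` gives the evaluation at the origin read along `s`. [cite: GortzWedhorn2020, (6.4) Prop. 6.7] [cite: GortzWedhorn2023, Rem. 27.18 (4) and (27.4.6)] -/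
theorem fstHom_comp_tangentHomOf :
    (fstHom R R R).toRingHom.comp (tangentHomOf s ℓ hℓs hℓK hℓ2) = s.comp (evalOrigin A) :=
  RingHom.ext fun a => fst_tangentHomOf_apply s ℓ hℓs hℓK hℓ2 a

/-- The ring homomorphism `R[ε] → S[ε]` induced by `e : R → S` on both components. [cite: GortzWedhorn2023, Rem. 27.18 (4) (functoriality of U ↦ G(U[ε]))] -/
def dualNumberMap (e : R →+* S) : DualNumber R →+* DualNumber S where
  toFun z := inl (e z.fst) + inr (e z.snd)
  map_one' := by rw [fst_one, snd_one, map_one, map_zero, inr_zero, add_zero]; rfl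
  map_mul' z w := by
    apply TrivSqZeroExt.ext
    · simp only [fst_add, fst_inl, fst_inr, add_zero, fst_mul, map_mul]
    · simp only [snd_add, snd_inl, snd_inr, zero_add, snd_mul, fst_add, fst_inl, fst_inr, add_zero,
        smul_eq_mul, MulOpposite.smul_eq_mul_unop, MulOpposite.unop_op, map_add, map_mul]
  map_zero' := by rw [fst_zero, snd_zero, map_zero, inl_zero, inr_zero, add_zero]
  map_add' z w := by
    rw [fst_add, snd_add, map_add, map_add, inl_add, inr_add]
    abel

/-- Components of `dualNumberMap e`. [cite: GortzWedhorn2023, Rem. 27.18 (4) (functoriality of U ↦ G(U[ε]))] -/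
theorem fst_dualNumberMap (e : R →+* S) (z : DualNumber R) : (dualNumberMap e z).fst = e z.fst := by
  change (inl (e z.fst) + inr (e z.snd) : DualNumber S).fst = _
  rw [fst_add, fst_inl, fst_inr, add_zero]

/-- Components of `dualNumberMap e`. [cite: GortzWedhorn2023, Rem. 27.18 (4) (functoriality of U ↦ G(U[ε]))] -/
theorem snd_dualNumberMap (e : R →+* S) (z : DualNumber R) : (dualNumberMap e z).snd = e z.snd := by
  change (inl (e z.fst) + inr (e z.snd) : DualNumber S).snd = _
  rw [snd_add, snd_inl, snd_inr, zero_add]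

/-- `dualNumberMap e ∘ inl = inl ∘ e`. [cite: GortzWedhorn2023, Rem. 27.18 (4) (functoriality of U ↦ G(U[ε]))] -/
theorem dualNumberMap_comp_inlHom (e : R →+* S) :
    (dualNumberMap e).comp (inlHom R R) = (inlHom S S).comp e := by
  ext r
  · rw [RingHom.comp_apply, fst_dualNumberMap, inlHom_apply, fst_inl, RingHom.comp_apply, inlHom_apply,
      fst_inl]
  · rw [RingHom.comp_apply, snd_dualNumberMap, inlHom_apply, snd_inl, map_zero, RingHom.comp_apply,
      inlHom_apply, snd_inl]

/-- `fst ∘ dualNumberMap e = e ∘ fst`. [cite: GortzWedhorn2023, Rem. 27.18 (4) (functoriality of U ↦ G(U[ε]))] -/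
theorem fstHom_comp_dualNumberMap (e : R →+* S) :
    (fstHom S S S).toRingHom.comp (dualNumberMap e) = e.comp (fstHom R R R).toRingHom :=
  RingHom.ext fun z => fst_dualNumberMap e z

/-- **Functoriality of the tangent vector in the coefficient ring**: `e[ε] ∘ t_{s,ℓ} = t_{e∘s,ℓ}`. [cite: GortzWedhorn2023, Rem. 27.18 (4) (functoriality of U ↦ G(U[ε]))] -/
theorem dualNumberMap_comp_tangentHomOf (e : R →+* S) :
    (dualNumberMap e).comp (tangentHomOf s ℓ hℓs hℓK hℓ2) = tangentHomOf (e.comp s) ℓ hℓs hℓK hℓ2 := by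
  ext a
  · rw [RingHom.comp_apply, fst_dualNumberMap, fst_tangentHomOf_apply, fst_tangentHomOf_apply,
      RingHom.comp_apply]
  · rw [RingHom.comp_apply, snd_dualNumberMap, snd_tangentHomOf_apply, snd_tangentHomOf_apply,
      RingHom.comp_apply]

end TangentOf

section TangentL

variable (L : Type u) [Field L] [Algebra K L]

variable (ℓ : stalkOrigin A →+ K)
  (hℓs : ∀ (c : K) (a : stalkOrigin A), ℓ (stalkOriginAlgebraMap A c * a) = c * ℓ a)
  (hℓK : ∀ c : K, ℓ (stalkOriginAlgebraMap A c) = 0)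
  (hℓ2 : ∀ x ∈ IsLocalRing.maximalIdeal (stalkOrigin A) ^ 2, ℓ x = 0)

/-- The `L[ε]`-valued tangent vector of `ℓ` for a field `L ⊇ K`: `tangentHomOf (algebraMap K L) ℓ`.
[cite: GortzWedhorn2023, Rem. 27.18 (4) and (27.4.6)] -/
abbrev tangentHomOfAlg : stalkOrigin A →+* DualNumber L := tangentHomOf (algebraMap K L) ℓ hℓs hℓK hℓ2

/-- The constant part of `tangentHomOfAlg ℓ` is evaluation at the origin. [cite: GortzWedhorn2020, (6.4) Prop. 6.7] [cite: GortzWedhorn2023, Rem. 27.18 (4) and (27.4.6)] -/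
theorem fst_tangentHomOfAlg_apply (a : stalkOrigin A) :
    (tangentHomOfAlg L ℓ hℓs hℓK hℓ2 a).fst = algebraMap K L (evalOrigin A a) :=
  fst_tangentHomOf_apply _ ℓ hℓs hℓK hℓ2 a

/-- The `ε`-part of `tangentHomOfAlg ℓ` is `ℓ`. [cite: GortzWedhorn2020, (6.4) Prop. 6.7] [cite: GortzWedhorn2023, Rem. 27.18 (4) and (27.4.6)] -/
theorem snd_tangentHomOfAlg_apply (a : stalkOrigin A) :
    (tangentHomOfAlg L ℓ hℓs hℓK hℓ2 a).snd = algebraMap K L (ℓ a) :=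
  snd_tangentHomOf_apply _ ℓ hℓs hℓK hℓ2 a

/-- `tangentHomOfAlg ℓ` is local. [cite: GortzWedhorn2020, (6.4) Prop. 6.7] [cite: GortzWedhorn2023, Rem. 27.18 (4) and (27.4.6)] -/
theorem isLocalHom_tangentHomOfAlg : IsLocalHom (CommRingCat.ofHom (tangentHomOfAlg L ℓ hℓs hℓK hℓ2)).hom :=
  ⟨fun a ha => by
    rw [CommRingCat.hom_ofHom, isUnit_iff_isUnit_fst, fst_tangentHomOfAlg_apply] at ha
    have h : evalOrigin A a ≠ 0 := fun h0 => by
      rw [h0, map_zero] at ha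
      exact not_isUnit_zero ha
    exact (isUnit_map_iff (evalOrigin A) a).mp (isUnit_iff_ne_zero.mpr h)⟩

/-- `tangentHomOfAlg ℓ` is a `K`-algebra map. [cite: GortzWedhorn2020, (6.4) Prop. 6.7] [cite: GortzWedhorn2023, Rem. 27.18 (4) and (27.4.6)] -/
theorem tangentHomOfAlg_comp_algebraMap :
    (CommRingCat.ofHom (tangentHomOfAlg L ℓ hℓs hℓK hℓ2)).hom.comp (stalkOriginAlgebraMap A) =
      algebraMap K (DualNumber L) :=
  tangentHomOf_comp_stalkOriginAlgebraMap _ ℓ hℓs hℓK hℓ2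

/-- **The `L[ε]`-point of `A` at the origin defined by the linear form `ℓ`** (`L`-valued tangent
vector, Görtz–Wedhorn II, (27.4.6)). [cite: GortzWedhorn2023, Rem. 27.18 (4) and (27.4.6)] -/
def tangentPtOfAlg : specOver K (DualNumber L) ⟶ A.X :=
  ptOver (CommRingCat.ofHom (tangentHomOfAlg L ℓ hℓs hℓK hℓ2)) (tangentHomOfAlg_comp_algebraMap L ℓ hℓs hℓK hℓ2)

/-- The tangent vector `tangentPtOfAlg ℓ` is based at the origin. [cite: GortzWedhorn2020, (6.4) Prop. 6.7] [cite: GortzWedhorn2023, Rem. 27.18 (4) and (27.4.6)] -/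
theorem basePt_tangentPtOfAlg : basePt (tangentPtOfAlg L ℓ hℓs hℓK hℓ2) = origin A := by
  haveI := isLocalHom_tangentHomOfAlg L ℓ hℓs hℓK hℓ2
  rw [basePt, tangentPtOfAlg, ptOver_left]
  exact ptOfStalkHom_closedPoint (R := CommRingCat.of (DualNumber L)) _

/-- The local homomorphism of `tangentPtOfAlg ℓ` is `tangentHomOfAlg ℓ`. [cite: GortzWedhorn2020, (6.4) Prop. 6.7] [cite: GortzWedhorn2023, Rem. 27.18 (4) and (27.4.6)] -/
theorem evAtPt_tangentPtOfAlg (h : (tangentPtOfAlg L ℓ hℓs hℓK hℓ2).left.base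
      (IsLocalRing.closedPoint (DualNumber L)) = origin A) :
    evAtPt (R := CommRingCat.of (DualNumber L)) (origin A) (tangentPtOfAlg L ℓ hℓs hℓK hℓ2).left h =
      CommRingCat.ofHom (tangentHomOfAlg L ℓ hℓs hℓK hℓ2) := by
  haveI := isLocalHom_tangentHomOfAlg L ℓ hℓs hℓK hℓ2
  exact evAt_ptOfStalkHom (R := CommRingCat.of (DualNumber L))
    (CommRingCat.ofHom (tangentHomOfAlg L ℓ hℓs hℓK hℓ2)) h

/-- `K → L` is a local homomorphism (a unit of `L` coming from `K` is nonzero in `K`). [cite: GortzWedhorn2020, (6.4) Prop. 6.7] [cite: GortzWedhorn2023, Rem. 27.18 (4) and (27.4.6)] -/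
theorem isLocalHom_algebraMap : IsLocalHom (CommRingCat.ofHom (algebraMap K L)).hom :=
  ⟨fun a ha => by
    rw [CommRingCat.hom_ofHom] at ha
    have h : a ≠ 0 := fun h0 => by
      rw [h0, map_zero] at ha
      exact not_isUnit_zero ha
    exact isUnit_iff_ne_zero.mpr h⟩

/-- The local homomorphism of the trivial `L`-point is evaluation at the origin read in `L`. [cite: GortzWedhorn2020, (6.4) Prop. 6.7] [cite: GortzWedhorn2023, Rem. 27.18 (4) and (27.4.6)] -/
theorem evAtPt_one :
    evAtPt (R := CommRingCat.of L) (origin A) (1 : specOver K L ⟶ A.X).left (one_left_base _) =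
      CommRingCat.ofHom ((algebraMap K L).comp (evalOrigin A)) := by
  haveI := isLocalHom_algebraMap (K := K) (L := L)
  have h1 : (1 : specOver K L ⟶ A.X) = specOverMapOfAlgHom (Algebra.ofId K L) ≫ (1 : specOver K K ⟶ A.X) :=
    (MonObj.comp_one _).symm
  have h1' : (1 : specOver K L ⟶ A.X).left =
      Spec.map (CommRingCat.ofHom (algebraMap K L)) ≫ (1 : specOver K K ⟶ A.X).left :=
    congrArg CommaMorphism.left h1
  rw [evAtPt_congr h1' _ (by rw [← h1']; exact one_left_base _),
    evAtPt_SpecMap_comp (x := origin A) (CommRingCat.ofHom (algebraMap K L)) (1 : specOver K K ⟶ A.X).left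
      (one_left_base _)]
  rfl

/-- **`tangentPtOfAlg ℓ` lies at the origin**: `Spec(aug) ≫ t_ℓ = 1` (both sides are the `L`-point with
local homomorphism `a ↦ ev_e(a)`). [cite: GortzWedhorn2020, (6.4) Prop. 6.7] [cite: GortzWedhorn2023, Rem. 27.18 (4) and (27.4.6)] -/
theorem tangentPtOfAlg_mem : tangentPtOfAlg L ℓ hℓs hℓK hℓ2 ∈ tangentL A L := by
  rw [mem_tangentL_iff]
  haveI := isLocalHom_augL (K := K) (L := L)
  have hb : (specOverMapOfAlgHom (augL K L) ≫ tangentPtOfAlg L ℓ hℓs hℓK hℓ2).left.base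
      (IsLocalRing.closedPoint L) = origin A := by
    rw [Over.comp_left, Scheme.Hom.comp_apply, specOverMapOfAlgHom_augL_closedPoint]
    exact basePt_tangentPtOfAlg L ℓ hℓs hℓK hℓ2
  apply Over.OverMorphism.ext
  apply eq_of_evAtPt_eq (R := CommRingCat.of L) hb (one_left_base _)
  have hl : (specOverMapOfAlgHom (augL K L) ≫ tangentPtOfAlg L ℓ hℓs hℓK hℓ2).left =
      Spec.map (CommRingCat.ofHom (augL K L).toRingHom) ≫ (tangentPtOfAlg L ℓ hℓs hℓK hℓ2).left := rfl
  rw [evAtPt_one, evAtPt_congr hl hb (hl ▸ hb),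
    evAtPt_SpecMap_comp (x := origin A) (CommRingCat.ofHom (augL K L).toRingHom) _
      (basePt_tangentPtOfAlg L ℓ hℓs hℓK hℓ2), evAtPt_tangentPtOfAlg]
  ext a
  change (tangentHomOfAlg L ℓ hℓs hℓK hℓ2 a).fst = algebraMap K L (evalOrigin A a)
  exact fst_tangentHomOfAlg_apply L ℓ hℓs hℓK hℓ2 a

/-- **At the origin the point derivation of `t_ℓ` is `ℓ`** (read in `L`). [cite: GortzWedhorn2020, (6.4) Prop. 6.7] [cite: GortzWedhorn2023, Rem. 27.18 (4) and (27.4.6)] -/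
theorem translatedDerivation_origin_tangentPtOfAlg (a : stalkOrigin A) :
    translatedDerivation (origin A) (1 : specOver K L ⟶ A.X) (one_left_base _)
        (tangentPtOfAlg L ℓ hℓs hℓK hℓ2) (tangentPtOfAlg_mem L ℓ hℓs hℓK hℓ2) a =
      algebraMap K L (ℓ a) := by
  have h1 : liftPt (1 : specOver K L ⟶ A.X) * tangentPtOfAlg L ℓ hℓs hℓK hℓ2 =
      tangentPtOfAlg L ℓ hℓs hℓK hℓ2 := by
    rw [liftPt, MonObj.comp_one, one_mul]
  have hP : specOverMapOfAlgHom (augL K L) ≫ tangentPtOfAlg L ℓ hℓs hℓK hℓ2 = 1 :=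
    (mem_tangentL_iff _).mp (tangentPtOfAlg_mem L ℓ hℓs hℓK hℓ2)
  rw [translatedDerivation, pointDerivation_congr _ _ _ h1 _ hP, pointDerivation_apply]
  change (evAtPt (R := CommRingCat.of (DualNumber L)) (origin A) (tangentPtOfAlg L ℓ hℓs hℓK hℓ2).left _ a).snd = _
  rw [evAtPt_tangentPtOfAlg]
  exact snd_tangentHomOfAlg_apply L ℓ hℓs hℓK hℓ2 a

end TangentL

/-! ### Linear independence of the translated derivations at every point -/

section Independence

variable {L : Type u} [Field L] [Algebra K L]
variable (x : A.X.left) (ξ : specOver K L ⟶ A.X) (hξ : basePt ξ = x)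

/-- **Translated tangent vectors stay linearly independent** (homogeneity of a group variety,
Görtz–Wedhorn II, Prop. 27.15 / Rem. 27.1, in the currency of dual-number points and WITHOUT rational
points, products or base change): let `ℓ i` (`i : J`) be linear forms on `𝔪_e/𝔪_e²` admitting dual
elements `a j ∈ 𝒪_{A,e}` (`ℓ i (a i) = 1`, `ℓ i (a j) = 0` for `i ≠ j`). Then for every field `L ⊇ K` and every `L`-point `ξ`
of `A` based at `x`, the `L`-valued point derivations at `x` obtained by translating the tangent vectors
`t_{ℓ i}` by `ξ` are `L`-linearly independent (as functions `𝒪_{A,x} → L`). Proof: a vanishing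
`L`-combination is the translated derivation of ONE tangent vector `T = ∏ (g i) · t_{ℓ i}`
(`translatedDerivation_prod_scale`), which is then trivial by cancellation in `A(L[ε])`
(`translatedDerivation_eq_zero_iff`); reading `T = 1` at the origin gives `∑ g i ℓ i = 0`, whence
`g = 0` on the dual elements. [cite: GortzWedhorn2023, Prop. 27.15 and Rem. 27.18 (3)–(4)] -/
theorem linearIndependent_translatedDerivation {J : Type*} (ℓ : J → (stalkOrigin A →+ K))
    (hℓs : ∀ i (c : K) (a : stalkOrigin A), ℓ i (stalkOriginAlgebraMap A c * a) = c * ℓ i a)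
    (hℓK : ∀ i (c : K), ℓ i (stalkOriginAlgebraMap A c) = 0)
    (hℓ2 : ∀ i, ∀ y ∈ IsLocalRing.maximalIdeal (stalkOrigin A) ^ 2, ℓ i y = 0)
    (a : J → stalkOrigin A) (ha : ∀ i, ℓ i (a i) = 1) (ha' : ∀ i j, i ≠ j → ℓ i (a j) = 0) :
    LinearIndependent L fun i => ⇑(translatedDerivation x ξ hξ
      (tangentPtOfAlg L (ℓ i) (hℓs i) (hℓK i) (hℓ2 i)) (tangentPtOfAlg_mem L (ℓ i) (hℓs i) (hℓK i) (hℓ2 i))) := by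
  classical
  rw [linearIndependent_iff']
  intro s g hsum i hi
  set t : J → (specOver K (DualNumber L) ⟶ A.X) :=
    fun i => tangentPtOfAlg L (ℓ i) (hℓs i) (hℓK i) (hℓ2 i) with ht_def
  have ht : ∀ i, t i ∈ tangentL A L := fun i => tangentPtOfAlg_mem L (ℓ i) (hℓs i) (hℓK i) (hℓ2 i)
  -- the single tangent vector `T = ∏ (g i) · t i` has vanishing translated derivation, hence is trivial
  have hT0 : translatedDerivation x ξ hξ (∏ i ∈ s, specOverMapOfAlgHom (scaleEps K (g i)) ≫ t i)
      (prod_scale_mem_tangentL s g t ht) = 0 := by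
    ext b
    rw [translatedDerivation_prod_scale x ξ hξ s g t ht b, AddMonoidHom.zero_apply]
    have := congr_fun hsum b
    simpa only [Finset.sum_apply, Pi.smul_apply, smul_eq_mul, Pi.zero_apply] using this
  have hT1 : (∏ i ∈ s, specOverMapOfAlgHom (scaleEps K (g i)) ≫ t i) = 1 :=
    (translatedDerivation_eq_zero_iff x ξ hξ _ _).mp hT0
  -- read `T = 1` at the origin
  have h0 : ∑ j ∈ s, g j * translatedDerivation (origin A) (1 : specOver K L ⟶ A.X) (one_left_base _)
      (t j) (ht j) (a i) = 0 := by
    rw [← translatedDerivation_prod_scale (origin A) (1 : specOver K L ⟶ A.X) (one_left_base _) s g t ht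
      (a i), translatedDerivation_congr _ _ _ hT1 _ (one_mem _), translatedDerivation_one,
      AddMonoidHom.zero_apply]
  have hval : ∀ j, translatedDerivation (origin A) (1 : specOver K L ⟶ A.X) (one_left_base _)
      (t j) (ht j) (a i) = algebraMap K L (ℓ j (a i)) := fun j =>
    translatedDerivation_origin_tangentPtOfAlg L (ℓ j) (hℓs j) (hℓK j) (hℓ2 j) (a i)
  simp only [hval] at h0
  rw [Finset.sum_eq_single i (fun j _ hji => by rw [ha' j i hji, map_zero, mul_zero])
    (fun h => absurd hi h), ha i, map_one, mul_one] at h0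
  exact h0

end Independence

end AbelianVariety

end Literature.AlgebraicGeometry.Motives

end
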